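import Literature.NumberTheory.EllipticCurves.NeronModel
import Literature.AlgebraicGeometry.Morphisms.FlatBirationalOpenImmersion
import HarnessLib

/-!
# Birational group laws on smooth models: the `(m, pr₂)` chart from the `(pr₁, m)` chart by the swap

Road W of the cell hodgecm-mathlib's r₀ programme ([BLRNeronModels1990] §4.3 / Def. 5.1/1, [EdixhovenRomagny2012]
Thm. 6.3: the group law of the generic fibre of a smooth model `𝒳 → Spec R` extends to an `R`-birational group
law).  In the (W0) skeleton (B-p18, `W0Skeleton`) the étale heart is the statement `core_fst`: for an
`R`-morphism `m : D → 𝒳` on an open `D ⊆ 𝒳 ×_R 𝒳` containing the generic fibre and restricting there to the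
multiplication of the `K`-group `E ≅ 𝒳_K`, the chart `Φ = (pr₁, m)` is flat and locally of finite presentation
near every point `ξ ∈ D` of the special fibre with `dim 𝒪_ξ ≤ 1`.  THIS FILE proves, sorry-free and with NO
commutativity hypothesis on `E`, that the twin statement for the other chart `Ψ = (m, pr₂)` FOLLOWS from
`core_fst` taken uniformly in the identification `e : 𝒳_K ≅ E`: apply it to the swapped datum
`(β⁻¹ D, (β ∣_ D) ≫ m, e ≪≫ asIso ι[E], β ξ)` — `β` the cartesian braiding of `Over (Spec R)`, `ι` the inversion
of `E`, using `y·x = (x⁻¹·y⁻¹)⁻¹` (`GrpObj.mul_inv_rev`) on the generic fibre — and transport back along `β` and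
`pullbackSymmetry`.  THEOREMS ONLY; the open-immersion property of the generic point `Spec K → Spec R` enters as
an instance binder.

* `genericFibre_map_braiding_mul_eq` — the group-theoretic identity on the generic fibre;
* `homOfLE_braiding_restrict_mul_eq` — the generic-fibre bookkeeping: `hgen` for `(D, m, e)` gives `hgen` for
  the swapped datum;
* `core_snd_of_core_fst` — the twin chart statement from the `e`-uniform `core_fst`.

## References
* [BLRNeronModels1990] S. Bosch, W. Lütkebohmert, M. Raynaud, *Néron Models*, Springer 1990, §4.3, Def. 5.1/1.
* [EdixhovenRomagny2012] B. Edixhoven, M. Romagny, *Group schemes out of birational group laws, Néron models*,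
  arXiv:1204.1799, Thm. 6.3.
* Tree: `Literature/NumberTheory/EllipticCurves/NeronModel.lean` (`genericFibre`, `specGenericPoint`); cell file
  `B-provers/B-p18/W0Skeleton.B-p18g7.lean` (`stub_core_fst`, whose text the hypothesis `hfst` copies).
-/

noncomputable section

universe u

namespace Literature.AlgebraicGeometry.GroupSchemes.BirationalGroupLawSwap

open CategoryTheory Limits _root_.AlgebraicGeometry MonoidalCategory CartesianMonoidalCategory
open Literature.NumberTheory.EllipticCurves
open scoped MonObj CategoryTheory.Obj

variable (R : Type u) [CommRing R] [IsDomain R] [IsDiscreteValuationRing R]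
  (K : Type u) [Field K] [Algebra R K] [IsOpenImmersion (specGenericPoint R K)]

variable (𝒳 : Over (Spec (.of R))) (E : Over (Spec (.of K))) [GrpObj E] (e : (genericFibre R K).obj 𝒳 ≅ E)

omit [IsDomain R] [IsDiscreteValuationRing R] [IsOpenImmersion (specGenericPoint R K)] in
/-- **The group-theoretic identity behind `e' := e ≪≫ asIso ι`**: on the generic fibre, swapping the two factors
of `𝒳 ⊗ 𝒳` and then multiplying through `e` is multiplying through `e ≪≫ asIso ι[E]` — `(x, y) ↦ y·x` is
`(x, y) ↦ (x⁻¹·y⁻¹)⁻¹` (Mathlib `GrpObj.mul_inv_rev`), read through the monoidal generic-fibre functor; no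
commutativity of `E` is used. [cite: BLRNeronModels1990, §4.3 and Def. 5.1/1] -/
theorem genericFibre_map_braiding_mul_eq :
    (genericFibre R K).map (β_ 𝒳 𝒳).hom ≫ Functor.OplaxMonoidal.δ (genericFibre R K) 𝒳 𝒳 ≫
        (e.hom ⊗ₘ e.hom) ≫ μ[E] ≫ e.inv =
      Functor.OplaxMonoidal.δ (genericFibre R K) 𝒳 𝒳 ≫
        ((e ≪≫ asIso ι[E]).hom ⊗ₘ (e ≪≫ asIso ι[E]).hom) ≫ μ[E] ≫ (e ≪≫ asIso ι[E]).inv := by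
  have h1 : (genericFibre R K).map (β_ 𝒳 𝒳).hom ≫
        Functor.OplaxMonoidal.δ (genericFibre R K) 𝒳 𝒳 ≫ (e.hom ⊗ₘ e.hom) =
      (Functor.OplaxMonoidal.δ (genericFibre R K) 𝒳 𝒳 ≫ (e.hom ⊗ₘ e.hom)) ≫ (β_ E E).hom := by
    ext <;> simp
  have h2 : ((e ≪≫ asIso ι[E]).hom ⊗ₘ (e ≪≫ asIso ι[E]).hom) ≫ μ[E] ≫ (e ≪≫ asIso ι[E]).inv =
      (e.hom ⊗ₘ e.hom) ≫ (β_ E E).hom ≫ μ[E] ≫ e.inv := by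
    simp only [Iso.trans_hom, Iso.trans_inv, asIso_hom, asIso_inv, GrpObj.inv_inv]
    rw [← tensorHom_comp_tensorHom, Category.assoc, GrpObj.tensorHom_inv_inv_mul_assoc,
      GrpObj.inv_comp_inv_assoc]
  rw [h2, reassoc_of% h1]

omit [IsDomain R] [IsDiscreteValuationRing R] in
/-- **Generic-fibre bookkeeping for the swap.**  If `m : D → 𝒳` restricts on the generic-fibre open to the
multiplication of `E` read through `e` (B-p18's `hgen`), then `(β ∣_ D) ≫ m : β⁻¹ D → 𝒳` restricts there to the
multiplication read through `e ≪≫ asIso ι[E]` — the hypothesis `hgen` of `stub_core_fst` for the swapped datum.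
(`β = β_ 𝒳 𝒳`; the generic fibre of `β` is the braiding of `𝒳_K ⊗ 𝒳_K`, `Over.pullback_map_left`, and
`genericFibre_map_braiding_mul_eq`.) [cite: BLRNeronModels1990, §4.3 and Def. 5.1/1] -/
theorem homOfLE_braiding_restrict_mul_eq
    (D : (𝒳 ⊗ 𝒳).left.Opens) (hD : (𝒳 ⊗ 𝒳).hom ⁻¹ᵁ (specGenericPoint R K).opensRange ≤ D)
    (m : (D : Scheme.{u}) ⟶ 𝒳.left)
    (hgen : (𝒳 ⊗ 𝒳).left.homOfLE hD ≫ m =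
      (IsOpenImmersion.isoOfRangeEq (pullback.fst (𝒳 ⊗ 𝒳).hom (specGenericPoint R K))
          ((𝒳 ⊗ 𝒳).hom ⁻¹ᵁ (specGenericPoint R K).opensRange).ι (by
            rw [Scheme.Opens.range_ι]
            exact IsOpenImmersion.range_pullbackFst (specGenericPoint R K) (𝒳 ⊗ 𝒳).hom)).inv ≫
        (Functor.OplaxMonoidal.δ (genericFibre R K) 𝒳 𝒳 ≫ (e.hom ⊗ₘ e.hom) ≫ μ[E] ≫ e.inv).left ≫
        pullback.fst 𝒳.hom (specGenericPoint R K))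
    (hD' : (𝒳 ⊗ 𝒳).hom ⁻¹ᵁ (specGenericPoint R K).opensRange ≤ (β_ 𝒳 𝒳).hom.left ⁻¹ᵁ D) :
 (𝒳 ⊗ 𝒳).left.homOfLE hD' ≫ (((β_ 𝒳 𝒳).hom.left ∣_ D) ≫ m) =
      (IsOpenImmersion.isoOfRangeEq (pullback.fst (𝒳 ⊗ 𝒳).hom (specGenericPoint R K))
          ((𝒳 ⊗ 𝒳).hom ⁻¹ᵁ (specGenericPoint R K).opensRange).ι (by
            rw [Scheme.Opens.range_ι]
            exact IsOpenImmersion.range_pullbackFst (specGenericPoint R K) (𝒳 ⊗ 𝒳).hom)).inv ≫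
        (Functor.OplaxMonoidal.δ (genericFibre R K) 𝒳 𝒳 ≫
          ((e ≪≫ asIso ι[E]).hom ⊗ₘ (e ≪≫ asIso ι[E]).hom) ≫ μ[E] ≫ (e ≪≫ asIso ι[E]).inv).left ≫
        pullback.fst 𝒳.hom (specGenericPoint R K)  := by
  have hA := genericFibre_map_braiding_mul_eq R K 𝒳 E e
  -- ### the generic-fibre iso `e₁ : (𝒳 ⊗ 𝒳)_K ≅ Y_K ⊆ Y` (the skeleton's inline `isoOfRangeEq`, with its source
  -- written as `((genericFibre R K).obj (𝒳 ⊗ 𝒳)).left`; the two spellings are definitionally equal)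
  have hrange : Set.range (pullback.fst (𝒳 ⊗ 𝒳).hom (specGenericPoint R K)) =
      Set.range ((𝒳 ⊗ 𝒳).hom ⁻¹ᵁ (specGenericPoint R K).opensRange).ι := by
    rw [Scheme.Opens.range_ι]
    exact IsOpenImmersion.range_pullbackFst (specGenericPoint R K) (𝒳 ⊗ 𝒳).hom
  haveI hoi : @IsOpenImmersion ((genericFibre R K).obj (𝒳 ⊗ 𝒳)).left (𝒳 ⊗ 𝒳).left
      (pullback.fst (𝒳 ⊗ 𝒳).hom (specGenericPoint R K)) :=
    (inferInstance : IsOpenImmersion (pullback.fst (𝒳 ⊗ 𝒳).hom (specGenericPoint R K)))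
  obtain ⟨e₁, he₁⟩ : ∃ e₁ : ((genericFibre R K).obj (𝒳 ⊗ 𝒳)).left ≅ ↑((𝒳 ⊗ 𝒳).hom ⁻¹ᵁ (specGenericPoint R K).opensRange),
      e₁ = IsOpenImmersion.isoOfRangeEq (X := ((genericFibre R K).obj (𝒳 ⊗ 𝒳)).left)
        (pullback.fst (𝒳 ⊗ 𝒳).hom (specGenericPoint R K)) ((𝒳 ⊗ 𝒳).hom ⁻¹ᵁ (specGenericPoint R K).opensRange).ι hrange := ⟨_, rfl⟩
  have hε₁ : e₁.hom ≫ ((𝒳 ⊗ 𝒳).hom ⁻¹ᵁ (specGenericPoint R K).opensRange).ι = pullback.fst (𝒳 ⊗ 𝒳).hom (specGenericPoint R K) := by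
    rw [he₁]; exact IsOpenImmersion.isoOfRangeEq_hom_fac _ _ _
  have hε₂ : ∀ {Z : Scheme.{u}} (h : (𝒳 ⊗ 𝒳).left ⟶ Z),
      e₁.inv ≫ (pullback.fst (𝒳 ⊗ 𝒳).hom (specGenericPoint R K) ≫ h :
        pullback (𝒳 ⊗ 𝒳).hom (specGenericPoint R K) ⟶ Z) = ((𝒳 ⊗ 𝒳).hom ⁻¹ᵁ (specGenericPoint R K).opensRange).ι ≫ h :=
    fun h => by rw [he₁]; exact IsOpenImmersion.isoOfRangeEq_inv_fac_assoc _ _ _ _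
  have hmapfst : ((genericFibre R K).map (β_ 𝒳 𝒳).hom).left ≫
        pullback.fst (𝒳 ⊗ 𝒳).hom (specGenericPoint R K) =
      pullback.fst (𝒳 ⊗ 𝒳).hom (specGenericPoint R K) ≫ (β_ 𝒳 𝒳).hom.left := by
    exact pullback.lift_fst _ _ _
  -- `hgen` read through `e₁`
  have hgen₁ : (𝒳 ⊗ 𝒳).left.homOfLE hD ≫ m =
      e₁.inv ≫ (Functor.OplaxMonoidal.δ (genericFibre R K) 𝒳 𝒳 ≫ (e.hom ⊗ₘ e.hom) ≫ μ[E] ≫ e.inv).left ≫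
        pullback.fst 𝒳.hom (specGenericPoint R K) := by
    rw [he₁]; exact hgen
  -- `hA` on underlying schemes, post-composed with the projection to `𝒳_K ⊆ 𝒳`
  have hA₁ : ((genericFibre R K).map (β_ 𝒳 𝒳).hom).left ≫
        (Functor.OplaxMonoidal.δ (genericFibre R K) 𝒳 𝒳 ≫ (e.hom ⊗ₘ e.hom) ≫ μ[E] ≫ e.inv).left ≫
          pullback.fst 𝒳.hom (specGenericPoint R K) =
      (Functor.OplaxMonoidal.δ (genericFibre R K) 𝒳 𝒳 ≫
          ((e ≪≫ asIso ι[E]).hom ⊗ₘ (e ≪≫ asIso ι[E]).hom) ≫ μ[E] ≫ (e ≪≫ asIso ι[E]).inv).left ≫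
        pullback.fst 𝒳.hom (specGenericPoint R K) := by
    rw [← hA, Over.comp_left (f := (genericFibre R K).map (β_ 𝒳 𝒳).hom)]
    exact (Category.assoc _ _ _).symm
  -- the restriction of `β` to the generic-fibre open is the generic fibre of `β`
  have hγ₁ : (𝒳 ⊗ 𝒳).left.homOfLE hD' ≫ ((β_ 𝒳 𝒳).hom.left ∣_ D) =
      (e₁.inv ≫ ((genericFibre R K).map (β_ 𝒳 𝒳).hom).left ≫ e₁.hom) ≫ (𝒳 ⊗ 𝒳).left.homOfLE hD := by
    rw [← cancel_mono D.ι]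
    simp only [Category.assoc, morphismRestrict_ι, Scheme.homOfLE_ι_assoc, Scheme.homOfLE_ι]
    rw [hε₁, hmapfst, hε₂]
  have hgen'₁ : (𝒳 ⊗ 𝒳).left.homOfLE hD' ≫ (((β_ 𝒳 𝒳).hom.left ∣_ D) ≫ m) =
      e₁.inv ≫ (Functor.OplaxMonoidal.δ (genericFibre R K) 𝒳 𝒳 ≫
          ((e ≪≫ asIso ι[E]).hom ⊗ₘ (e ≪≫ asIso ι[E]).hom) ≫ μ[E] ≫ (e ≪≫ asIso ι[E]).inv).left ≫
        pullback.fst 𝒳.hom (specGenericPoint R K) := by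
    rw [← Category.assoc, hγ₁]
    simp only [Category.assoc]
    rw [hgen₁, Iso.hom_inv_id_assoc, hA₁]
  have h := hgen'₁
  rw [he₁] at h
  exact h

/-- **`stub_core_snd` from `stub_core_fst` by the swap.**  If, for EVERY identification `e'` of the
generic fibre of `𝒳` with the group `E`, the morphism `Φ = (pr₁, m)` attached to an `R`-extension
`m : D → 𝒳` of the multiplication (read through `e'`) is flat and locally of finite presentation
near any point `ξ ∈ D` over the closed point with `dim 𝒪_ξ ≤ 1` (the (W0) skeleton's `core_fst`,
uniformly in `e'`), then the same holds for `Ψ = (m, pr₂)`.  Proof: apply the hypothesis to the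
swapped datum `(β⁻¹ D, (β ∣_ D) ≫ m, e ≪≫ asIso ι, β ξ)` and transport along `β` and
`pullbackSymmetry`. [cite: BLRNeronModels1990, §4.3 and Def. 5.1/1] [cite: EdixhovenRomagny2012, Thm. 6.3] -/
theorem core_snd_of_core_fst
    (hfst : ∀ (e' : (genericFibre R K).obj 𝒳 ≅ E) (D : (𝒳 ⊗ 𝒳).left.Opens)
      (hD : (𝒳 ⊗ 𝒳).hom ⁻¹ᵁ (specGenericPoint R K).opensRange ≤ D)
      (m : (D : Scheme.{u}) ⟶ 𝒳.left) (hm : m ≫ 𝒳.hom = D.ι ≫ (𝒳 ⊗ 𝒳).hom)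
      (_hgen : (𝒳 ⊗ 𝒳).left.homOfLE hD ≫ m =
        (IsOpenImmersion.isoOfRangeEq (pullback.fst (𝒳 ⊗ 𝒳).hom (specGenericPoint R K))
            ((𝒳 ⊗ 𝒳).hom ⁻¹ᵁ (specGenericPoint R K).opensRange).ι (by
              rw [Scheme.Opens.range_ι]
              exact IsOpenImmersion.range_pullbackFst (specGenericPoint R K) (𝒳 ⊗ 𝒳).hom)).inv ≫
          (Functor.OplaxMonoidal.δ (genericFibre R K) 𝒳 𝒳 ≫ (e'.hom ⊗ₘ e'.hom) ≫ μ[E] ≫ e'.inv).left ≫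
          pullback.fst 𝒳.hom (specGenericPoint R K))
      (ξ : (𝒳 ⊗ 𝒳).left) (_hξD : ξ ∈ D) (_hξs : (𝒳 ⊗ 𝒳).hom.base ξ = IsLocalRing.closedPoint R)
      (_hξ1 : ringKrullDim ((𝒳 ⊗ 𝒳).left.presheaf.stalk ξ) ≤ 1),
      ∃ (V : (𝒳 ⊗ 𝒳).left.Opens) (hVD : V ≤ D), ξ ∈ V ∧
        Flat (pullback.lift (V.ι ≫ (fst 𝒳 𝒳).left) ((𝒳 ⊗ 𝒳).left.homOfLE hVD ≫ m)
          (by rw [Category.assoc, Over.w (fst 𝒳 𝒳), Category.assoc, hm, ← Category.assoc,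
                Scheme.homOfLE_ι]) :
          (V : Scheme.{u}) ⟶ pullback 𝒳.hom 𝒳.hom) ∧
        LocallyOfFinitePresentation (pullback.lift (V.ι ≫ (fst 𝒳 𝒳).left)
          ((𝒳 ⊗ 𝒳).left.homOfLE hVD ≫ m)
          (by rw [Category.assoc, Over.w (fst 𝒳 𝒳), Category.assoc, hm, ← Category.assoc,
                Scheme.homOfLE_ι])))
    (D : (𝒳 ⊗ 𝒳).left.Opens) (hD : (𝒳 ⊗ 𝒳).hom ⁻¹ᵁ (specGenericPoint R K).opensRange ≤ D)
    (m : (D : Scheme.{u}) ⟶ 𝒳.left) (hm : m ≫ 𝒳.hom = D.ι ≫ (𝒳 ⊗ 𝒳).hom)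
    (hgen : (𝒳 ⊗ 𝒳).left.homOfLE hD ≫ m =
      (IsOpenImmersion.isoOfRangeEq (pullback.fst (𝒳 ⊗ 𝒳).hom (specGenericPoint R K))
          ((𝒳 ⊗ 𝒳).hom ⁻¹ᵁ (specGenericPoint R K).opensRange).ι (by
            rw [Scheme.Opens.range_ι]
            exact IsOpenImmersion.range_pullbackFst (specGenericPoint R K) (𝒳 ⊗ 𝒳).hom)).inv ≫
        (Functor.OplaxMonoidal.δ (genericFibre R K) 𝒳 𝒳 ≫ (e.hom ⊗ₘ e.hom) ≫ μ[E] ≫ e.inv).left ≫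
        pullback.fst 𝒳.hom (specGenericPoint R K))
    (ξ : (𝒳 ⊗ 𝒳).left) (hξD : ξ ∈ D) (hξs : (𝒳 ⊗ 𝒳).hom.base ξ = IsLocalRing.closedPoint R)
    (hξ1 : ringKrullDim ((𝒳 ⊗ 𝒳).left.presheaf.stalk ξ) ≤ 1) :
    ∃ (W : (𝒳 ⊗ 𝒳).left.Opens) (hWD : W ≤ D), ξ ∈ W ∧
      Flat (pullback.lift ((𝒳 ⊗ 𝒳).left.homOfLE hWD ≫ m) (W.ι ≫ (snd 𝒳 𝒳).left)
        (by rw [Category.assoc, hm, ← Category.assoc, Scheme.homOfLE_ι, Category.assoc,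
              Over.w (snd 𝒳 𝒳)]) :
        (W : Scheme.{u}) ⟶ pullback 𝒳.hom 𝒳.hom) ∧
      LocallyOfFinitePresentation (pullback.lift ((𝒳 ⊗ 𝒳).left.homOfLE hWD ≫ m)
        (W.ι ≫ (snd 𝒳 𝒳).left)
        (by rw [Category.assoc, hm, ← Category.assoc, Scheme.homOfLE_ι, Category.assoc,
              Over.w (snd 𝒳 𝒳)])) := by
  -- ### (0) the swap `β` of `𝒳 ⊗ 𝒳` over `R`, an involution over `Spec R`
  have hβY : (β_ 𝒳 𝒳).hom.left ≫ (𝒳 ⊗ 𝒳).hom = (𝒳 ⊗ 𝒳).hom := Over.w _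
  have hββ : (β_ 𝒳 𝒳).hom.left ≫ (β_ 𝒳 𝒳).hom.left = 𝟙 _ := by
    rw [← Over.comp_left, SymmetricCategory.symmetry, Over.id_left]
  have hβiso : IsIso (β_ 𝒳 𝒳).hom.left :=
    ⟨⟨(β_ 𝒳 𝒳).inv.left, by rw [← Over.comp_left, Iso.hom_inv_id, Over.id_left], by
      rw [← Over.comp_left, Iso.inv_hom_id, Over.id_left]⟩⟩
  have hββx : ∀ x : ↥(𝒳 ⊗ 𝒳).left,
      (β_ 𝒳 𝒳).hom.left.base ((β_ 𝒳 𝒳).hom.left.base x) = x := fun x => by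
    have h := congrArg (fun φ : (𝒳 ⊗ 𝒳).left ⟶ (𝒳 ⊗ 𝒳).left => φ.base x) hββ
    simp only [Scheme.Hom.comp_base, TopCat.comp_app, Scheme.Hom.id_base, TopCat.id_app] at h
    exact h
  have hβYx : ∀ x : ↥(𝒳 ⊗ 𝒳).left,
      (𝒳 ⊗ 𝒳).hom.base ((β_ 𝒳 𝒳).hom.left.base x) = (𝒳 ⊗ 𝒳).hom.base x := fun x => by
    have h := congrArg (fun φ : (𝒳 ⊗ 𝒳).left ⟶ Spec (.of R) => φ.base x) hβY
    simp only [Scheme.Hom.comp_base, TopCat.comp_app] at h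
    exact h
  -- ### (2) the swapped datum `(D', m') := (β⁻¹ D, (β ∣_ D) ≫ m)` and its hypotheses
  have hD' : (𝒳 ⊗ 𝒳).hom ⁻¹ᵁ (specGenericPoint R K).opensRange ≤ (β_ 𝒳 𝒳).hom.left ⁻¹ᵁ D := by
    intro x hx
    change (β_ 𝒳 𝒳).hom.left.base x ∈ (D : Set ↥(𝒳 ⊗ 𝒳).left)
    apply hD
    have hx' : (𝒳 ⊗ 𝒳).hom.base x ∈ (specGenericPoint R K).opensRange := hx
    show (𝒳 ⊗ 𝒳).hom.base ((β_ 𝒳 𝒳).hom.left.base x) ∈ (specGenericPoint R K).opensRange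
    rw [hβYx]
    exact hx'
  have hm' : (((β_ 𝒳 𝒳).hom.left ∣_ D) ≫ m) ≫ 𝒳.hom =
      ((β_ 𝒳 𝒳).hom.left ⁻¹ᵁ D).ι ≫ (𝒳 ⊗ 𝒳).hom := by
    rw [Category.assoc, hm, morphismRestrict_ι_assoc, hβY]
  have hgen' := homOfLE_braiding_restrict_mul_eq R K 𝒳 E e D hD m hgen hD'
  -- the swapped point `ξ' := β ξ`
  have hξ'D : (β_ 𝒳 𝒳).hom.left.base ξ ∈ (β_ 𝒳 𝒳).hom.left ⁻¹ᵁ D := by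
    change (β_ 𝒳 𝒳).hom.left.base ((β_ 𝒳 𝒳).hom.left.base ξ) ∈ (D : Set ↥(𝒳 ⊗ 𝒳).left)
    rw [hββx]
    exact hξD
  have hξ's : (𝒳 ⊗ 𝒳).hom.base ((β_ 𝒳 𝒳).hom.left.base ξ) = IsLocalRing.closedPoint R := by
    rw [hβYx]; exact hξs
  have hξ'1 : ringKrullDim ((𝒳 ⊗ 𝒳).left.presheaf.stalk ((β_ 𝒳 𝒳).hom.left.base ξ)) ≤ 1 := by
    rw [ringKrullDim_eq_of_ringEquiv (asIso ((β_ 𝒳 𝒳).hom.left.stalkMap ξ)).commRingCatIsoToRingEquiv]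
    exact hξ1
  -- ### (3) the étale heart for the swapped datum
  obtain ⟨V, hVD', hξV, hflat, hlfp⟩ := hfst (e ≪≫ asIso ι[E]) ((β_ 𝒳 𝒳).hom.left ⁻¹ᵁ D) hD'
    (((β_ 𝒳 𝒳).hom.left ∣_ D) ≫ m) hm' hgen' ((β_ 𝒳 𝒳).hom.left.base ξ) hξ'D hξ's hξ'1
  -- ### (4) transport back: `W := β⁻¹ V ∋ ξ`, `Ψ_W = (β ∣_ V) ≫ Φ' ≫ swap`
  have hWD : (β_ 𝒳 𝒳).hom.left ⁻¹ᵁ V ≤ D := by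
    intro x hx
    have hx' : (β_ 𝒳 𝒳).hom.left.base x ∈ (V : Set ↥(𝒳 ⊗ 𝒳).left) := hx
    have hx'' := hVD' hx'
    change (β_ 𝒳 𝒳).hom.left.base ((β_ 𝒳 𝒳).hom.left.base x) ∈ (D : Set ↥(𝒳 ⊗ 𝒳).left) at hx''
    rwa [hββx] at hx''
  have hξW : ξ ∈ (β_ 𝒳 𝒳).hom.left ⁻¹ᵁ V := hξV
  have hW' : ((β_ 𝒳 𝒳).hom.left ∣_ V) ≫ (𝒳 ⊗ 𝒳).left.homOfLE hVD' ≫ ((β_ 𝒳 𝒳).hom.left ∣_ D) =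
      (𝒳 ⊗ 𝒳).left.homOfLE hWD := by
    rw [← cancel_mono D.ι]
    simp only [Category.assoc, morphismRestrict_ι, Scheme.homOfLE_ι_assoc, Scheme.homOfLE_ι,
      morphismRestrict_ι_assoc, hββ, Category.comp_id]
  have hΨ : pullback.lift ((𝒳 ⊗ 𝒳).left.homOfLE hWD ≫ m) (((β_ 𝒳 𝒳).hom.left ⁻¹ᵁ V).ι ≫ (snd 𝒳 𝒳).left)
        (by rw [Category.assoc, hm, ← Category.assoc, Scheme.homOfLE_ι, Category.assoc,
              Over.w (snd 𝒳 𝒳)]) =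
      ((β_ 𝒳 𝒳).hom.left ∣_ V) ≫
        pullback.lift (V.ι ≫ (fst 𝒳 𝒳).left)
          ((𝒳 ⊗ 𝒳).left.homOfLE hVD' ≫ (((β_ 𝒳 𝒳).hom.left ∣_ D) ≫ m))
          (by rw [Category.assoc, Over.w (fst 𝒳 𝒳), Category.assoc, hm', ← Category.assoc,
                Scheme.homOfLE_ι]) ≫
        (pullbackSymmetry 𝒳.hom 𝒳.hom).hom := by
    apply pullback.hom_ext
    · simp only [Category.assoc, pullback.lift_fst, pullbackSymmetry_hom_comp_fst, pullback.lift_snd]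
      rw [← hW', Category.assoc, Category.assoc]
    · simp only [Category.assoc, pullback.lift_snd, pullbackSymmetry_hom_comp_snd, pullback.lift_fst]
      rw [morphismRestrict_ι_assoc, ← Over.comp_left, braiding_hom_fst]
  haveI : Flat ((β_ 𝒳 𝒳).hom.left ∣_ V) := inferInstance
  haveI : LocallyOfFinitePresentation ((β_ 𝒳 𝒳).hom.left ∣_ V) := inferInstance
  haveI : Flat (pullbackSymmetry 𝒳.hom 𝒳.hom).hom := inferInstance
  haveI : LocallyOfFinitePresentation (pullbackSymmetry 𝒳.hom 𝒳.hom).hom := inferInstance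
  refine ⟨(β_ 𝒳 𝒳).hom.left ⁻¹ᵁ V, hWD, hξW, ?_, ?_⟩
  · rw [hΨ]; infer_instance
  · rw [hΨ]; infer_instance

end Literature.AlgebraicGeometry.GroupSchemes.BirationalGroupLawSwap

end
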